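import Summits.RiemannHypothesis.RiemannHypothesis.Theorems.PfPersistenceF6LadderScaleFree

/-!
# Pf-persistence, fake seat 6 (gen 2): the harness ladder in LOG coordinates is blind to per-window
# log-AFFINE COMPRESSION; forward gap rigidity reads the compression factor

mechanism/rigidity campaign; no RH claims.

The served form of cand-8's ladder reader (harness `_ladder`, rows cand8-003 / cand8-006 / cand8-007) works on the
base-10 logarithms `l 0 < l 1 < l 2 < l 3` of the merged bottom feet `|e₁| , o₁ , e₂ , o₂` of a window: with the gaps
`g i = l (i+1) - l i` its value is `min (g 0 - g 1, g 1 - g 2) + κ` (`κ = 1/4`), required `≥ 0`.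

* `logLadder κ l` — that predicate (gaps positive, the two second differences `≥ -κ`).
* `logLadder_affine` — PROVED: for `0 ≤ κ`, `0 < α ≤ 1` and any `β`, `logLadder κ l → logLadder κ (α • l + β)`:
  a log-affine COMPRESSION of a valid ladder is a valid ladder.  This is the typed form of the transport-twin
  mechanism of FAKES §6.6: at the far window the twin shows a compressed (`α ≈ 0.2–0.35`) and shifted copy of a
  valid ladder, and the k-window look-ahead conjunction (`PfPersistence.F6.lookAheadConj`) of a reader with this
  invariance cannot object (`lookAheadConj_logAffine`).
* `gapRigid ρ l l'` — cand8-010's forward GAP RIGIDITY `g' i ≥ ρ · g i` (`ρ = 0.8`), and `gapRigid_affine_iff` —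
  PROVED: on the pair `(l, α • l + β)` with positive gaps it holds IFF `ρ ≤ α`: the new conjunct reads the
  compression factor directly, which is why it rejects the five certified twins (`α ≤ 0.33 < 0.8`) while
  cand8-006 accepts them.

All statements are elementary real (in)equalities; nothing here is specific to ζ. [folklore]
-/

namespace Summit.RiemannHypothesis.RiemannHypothesis.Theorems.PfPersistence.F6

/-- the harness ladder in log coordinates: `l 0 < l 1 < l 2 < l 3` are `lg |e₁|, lg o₁, lg e₂, lg o₂`; the two
log-concavity conjuncts say the consecutive gaps shrink by at most `κ` (`κ = 1/4` in the rows of record). [folklore] -/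
def logLadder (κ : ℝ) (l : ℕ → ℝ) : Prop :=
  l 0 < l 1 ∧ l 1 < l 2 ∧ l 2 < l 3 ∧ l 0 + l 2 ≤ κ + 2 * l 1 ∧ l 1 + l 3 ≤ κ + 2 * l 2

/-- PROVED: a log-affine compression `l ↦ α l + β` with `0 < α ≤ 1` maps valid ladders to valid ladders (`0 ≤ κ`). [folklore] -/
theorem logLadder_affine {κ α : ℝ} (hκ : 0 ≤ κ) (hα : 0 < α) (hα1 : α ≤ 1) (β : ℝ) {l : ℕ → ℝ}
    (h : logLadder κ l) : logLadder κ (fun i => α * l i + β) := by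
  obtain ⟨h1, h2, h3, h4, h5⟩ := h
  refine ⟨by nlinarith, by nlinarith, by nlinarith, ?_, ?_⟩
  · -- α (l0 + l2 - 2 l1) ≤ α κ ≤ κ
    have : α * (l 0 + l 2 - 2 * l 1) ≤ α * κ := mul_le_mul_of_nonneg_left (by linarith) hα.le
    nlinarith
  · have : α * (l 1 + l 3 - 2 * l 2) ≤ α * κ := mul_le_mul_of_nonneg_left (by linarith) hα.le
    nlinarith

/-- PROVED: an EXPANSION (`1 < α`) can break the ladder — the invariance is one-sided: `κ = 1/4`,
`l = (0, 1, 9/4, 15/4)` has gaps `1, 5/4, 3/2` growing by exactly `κ` (valid), and `α = 2` doubles the growth. [folklore] -/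
theorem logLadder_expansion_counterexample :
    logLadder (1/4) (fun i => if i = 0 then 0 else if i = 1 then 1 else if i = 2 then 9/4 else 15/4) ∧
    ¬ logLadder (1/4) (fun i => 2 * (if i = 0 then (0:ℝ) else if i = 1 then 1 else if i = 2 then 9/4 else 15/4) + 0) := by
  constructor
  · simp only [logLadder]; norm_num
  · simp only [logLadder]; norm_num

/-- the look-ahead conjunction of the log-ladder over `k` served windows (`L j` = the log-ladder at window `j`). [folklore] -/
def logLookAhead (κ : ℝ) (k : ℕ) (L : ℕ → ℕ → ℝ) : Prop :=
  ∀ j < k, logLadder κ (L j)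

/-- PROVED (typed transport-twin mechanism): compressing EACH window's log-ladder by its own factor `α j ∈ (0,1]`
and shift `β j` preserves the k-window look-ahead conjunction — cand8-006 (`k = 2`) and cand8-007 (`k = 3`)
put no lower bound on how strongly a later window's ladder is compressed relative to an earlier one. [folklore] -/
theorem logLookAhead_compress {κ : ℝ} (hκ : 0 ≤ κ) (k : ℕ) {L : ℕ → ℕ → ℝ} (α β : ℕ → ℝ)
    (hα : ∀ j < k, 0 < α j ∧ α j ≤ 1) (h : logLookAhead κ k L) :
    logLookAhead κ k (fun j i => α j * L j i + β j) :=
  fun j hj => logLadder_affine hκ (hα j hj).1 (hα j hj).2 (β j) (h j hj)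

/-- cand8-010's forward GAP RIGIDITY between a window's log-ladder `l` and the next window's `l'`:
every consecutive gap keeps at least the fraction `ρ` of its size (`ρ = 0.8` in the row). [folklore] -/
def gapRigid (ρ : ℝ) (l l' : ℕ → ℝ) : Prop :=
  ∀ i < 3, ρ * (l (i+1) - l i) ≤ l' (i+1) - l' i

/-- PROVED: on a compressed copy `l' = α l + β` of a ladder with positive gaps, gap rigidity holds IFF `ρ ≤ α` —
the conjunct reads the compression factor, so it rejects the certified twins (`α ≤ 0.33`) at `ρ = 0.8`. [folklore] -/
theorem gapRigid_affine_iff {ρ α β : ℝ} {l : ℕ → ℝ} (hgap : ∀ i < 3, l i < l (i+1)) :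
    gapRigid ρ l (fun i => α * l i + β) ↔ ρ ≤ α := by
  constructor
  · intro h
    have h0 := h 0 (by norm_num)
    have g0 := hgap 0 (by norm_num)
    -- ρ g ≤ α g with g > 0
    have : ρ * (l 1 - l 0) ≤ α * (l 1 - l 0) := by simpa [mul_sub] using h0
    exact le_of_mul_le_mul_right this (by linarith)
  · intro h i hi
    have gi := hgap i hi
    have : ρ * (l (i+1) - l i) ≤ α * (l (i+1) - l i) := mul_le_mul_of_nonneg_right h (by linarith)
    simpa [mul_sub] using this

/-- PROVED (the dichotomy in one line): for `0 < α < ρ ≤ 1` the compressed pair PASSES the look-ahead ladder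
conjunction and FAILS gap rigidity. [folklore] -/
theorem compressedTwin_splits {κ ρ α β : ℝ} (hκ : 0 ≤ κ) (hα : 0 < α) (hαρ : α < ρ) (hρ : ρ ≤ 1)
    {l : ℕ → ℝ} (h : logLadder κ l) :
    logLookAhead κ 2 (fun j i => if j = 0 then l i else α * l i + β) ∧
    ¬ gapRigid ρ l (fun i => α * l i + β) := by
  have hc := h
  obtain ⟨h1, h2, h3, _, _⟩ := hc
  refine ⟨?_, ?_⟩
  · intro j hj
    interval_cases j
    · simpa using h
    · simpa using logLadder_affine hκ hα (le_of_lt (lt_of_lt_of_le hαρ hρ)) β h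
  · have hgap : ∀ i < 3, l i < l (i+1) := by
      intro i hi
      interval_cases i <;> simpa
    rw [gapRigid_affine_iff hgap]
    exact not_le.mpr hαρ

end Summit.RiemannHypothesis.RiemannHypothesis.Theorems.PfPersistence.F6
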